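import Literature.MathematicalPhysics.QuantumFieldTheory.Balaban1983to89.B9Thm310CommutatorBound389BMajorant
import Literature.MathematicalPhysics.QuantumFieldTheory.Balaban1983to89.B9CubeLettersInvReadDictB

/-!
# `Balaban1983to89.B9Thm310CommutatorBound389BOfInv` — T. Bałaban, *Propagators for lattice gauge theories in a background field*, Commun. Math. Phys.
# **99** (1985) 389–434 [Balaban1985BackgroundPropagators], p. 414 «The operator K(h_□)G_□h_□ satisfies the inequality (3.89), hence it is small» FOR A BOND
# CUBE LETTER GIVEN BY ITS THEOREM-3.3 BLOCK OVER THE INVARIANT CLASS: the JUNCTION of this seat's E′₂b ∕ E′₃ (`B9Thm310CommutatorBound389B(Majorant)`)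
# with the bond-sector dictionary `B9CubeLettersInvReadDictB` (sub-row G-B9-LETTERS, module M5.7-est, file E′₄)

statement-level skeleton of published theorems with citation tags; proofs where landed; nothing here is a claim about the Yang–Mills mass gap

PDF held: `paper:balaban1985-cmp99-background-propagators` (journal page = PDF page + 388); pp. 397, 399, 409, 413–414 read from the held text layer.
p. 413: «An operator R(X) has the following important properties: it is localized in X, i.e. its kernel has a support in X × X, it depends on U
restricted to X̃, and satisfies a bound of the type (3.89), possibly with an additional power of Lʲη.» (said of the factors «R′_α(X)» two sentences earlier); p. 414: «Δ_aG₀ = I − Σ_□K(h_□)G_□h_□ − … = I − R. (3.105) … The operator K(h_□)G_□h_□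
satisfies the inequality (3.89), hence it is small»; p. 399 Thm 3.3: «the operator G(U) (a = 1) satisfies the inequalities (3.42)–(3.47), with G′(U) replaced
by G(U) and λ replaced by a function J defined at bonds of the lattice T_η, or Ω₀, and with values in g»; (3.89) p. 409: «|(K(h_□)G′_□h_□λ)(x)| ≤
O(M⁻¹)e^{−δ₀(Lʲη)⁻¹|y−y′|}|λ| for x∈Δ(y), supp λ ⊂ Δ(y′), y, y′∈□∈𝒟_j».

WHAT THIS FILE IS.  E′₂b bounds `K(h_□)(U)·O·h_□` at a bond for ANY ℂ-linear bond operator `O` obeying DISPLAYED Thm-3.3-type value ∕ gradient entries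
(`h342₀`, `h342₁`); E′₃ turns that into the `Factors389.fac` block majorant of the Theorem 3.10 glue; DictB-READ serves exactly those two displayed entries
from the (3.42) block `EBlock (kernelFamilyBInv i B cfg O par) B₀ δ U₁` of p21's invariant-class reading of a bond-sector letter `O : BondOpY 𝔸 i` (the
object the M5.1c ∕ M5.2-type modules establish for the cube letters `G_□(U)`, r05's `B9CubeLettersBondOpsL0`).  THIS FILE composes them: from the (3.42)
block of `O` at `U₁` (plus E′₂b's side hypotheses at `U = cfg U₁`) — (A) ★★ `norm_KhBY_hTY_apply_le_of_eBlockInvB`, the pointwise bond-sector (3.89) for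
`K(h_□)(U)(O(U)(h_□Λ))`, every `Λ` of the class of `J`; (B) ★★ `hasMajorant_conj_KhBY_hTY_of_eBlockInvB`, the `fac`-shaped block majorant
`1[a ∈ S′_□]·M₂(Σ_j‖b_j‖)·θ₃₈₉ᴮ∕((ℓ+1)·M_h)·e^{−δ d(a,a′)}` of the conjugated remainder letter, and (C) ★★ `hasMajorant_conj_KhBY_hTY_of_eBlockInvB_fac`, the
same majorant in the glue's LITERAL `B9Thm310Whole.Factors389.fac` summand shape `1[a ∈ SF]·θ₀·M⁻¹·e^{−δ d(a,a′)}` with `M = (geo9K i).M = (ℓ+1)·M_h` and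
`θ₀ := M₂(Σ_j‖b_j‖)·θ₃₈₉ᴮ(j)`.  Two `exact`s and one rescaling; the mathematics is in the three imports.
HONEST SCOPE.  Exactly as E′₂b ∕ E′₃: the (3.42) block is a HYPOTHESIS (`hE`), nothing of Thm 3.3 ∕ 3.10 is asserted; the real basis `b` (coordinate
bound `M₂`) enters (A) only through the finite-dimensional boundedness of the class sups (p21's device) and (B) through the coordinates; same rate `δ`;
corner-free members; `η = |c_f|⁻¹`; E′₁'s GLOBAL holonomy-defect constants, so `θ₃₈₉ᴮ` carries `δ_P·(ℓ+1)^j` (exact print statement at `U = 1`; the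
(3.35)-localised form is the successor's); the sets `S′_□` (block `2ℓ + 6`-neighbourhoods of `supp h_□`) and their overlap count are the glue's static
data, not computed here; nothing continuum ∕ OS ∕ mass gap ∕ Clay; YM mass gap NOT proved by any of this (Track A conditional rung).
`--supports stmt-QuantumFields-19200`.  Net new unproved facts: 0.
-/

noncomputable section

namespace Literature.MathematicalPhysics.QuantumFieldTheory.Balaban1983to89.B9Thm310CommutatorBound389BOfInv

open Node00 B9CubeLettersInvReadings
open B9Thm37CubeCoverCommutators (cutMulY hTY)
open B9Eq3104CutoffCommutators (hBdY KhBY)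
open B9Thm310CommutatorBound389B (theta389B norm_KhBY_O_hTY_apply_le)
open B9Thm310CommutatorBound389BMajorant (hasMajorant_conj_of_bound389B)
open B9CubeLettersInvReadDictB (h342₀_of_eBlockInvB h342₁_of_eBlockInvB)
open B6KLevelCensusIndexV1 (KIdx)
open B6Ineq2142KLevelV1 (β)
open B6GlobalChartV1 (blkV1)
open B6Geom246MultiLevelBox (blkOf)
open B6Geom246MultiLevelTorus (bondT)
open B6Cover236MultiLevelBlocks (cubes)
open B6RandomWalk (HasMajorant hasMajorant_mono)
open B9Thm34Ext (toB6)
open B9FromB6 (EBlock)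
open B9GeoNormsKLevelV1 (geo9K)
open B9Eq352DivFormLetters (conj)
open B9Eq39Adjoint (R plaqU)
open B9Eq3104CommutatorSizesCurl (jIns)
open scoped Matrix

variable {𝔸 : Type} [NormedRing 𝔸] [NormedAlgebra ℂ 𝔸] [CompleteSpace 𝔸]
variable {d ℓ : ℕ} {hd : 1 ≤ d + 1} {hL : Odd (ℓ + 1) ∧ 1 < ℓ + 1} {b₀ b₁ : ℝ}
variable {ι : Type} [Fintype ι]
variable (i : KIdx d ℓ hd hL b₀ b₁) (b : Module.Basis ι ℝ 𝔸)
variable {B : B9.Backgrounds} (cfg : B.Cfg → CfgY 𝔸 i) (O : BondOpY 𝔸 i) (par : BondParY 𝔸 i) {B₀ δ : ℝ} {U₁ : B.Cfg}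

/-- ★★ **(A) THE BOND-SECTOR (3.89) FOR `K(h_□)G_□(U)h_□`, `G_□` GIVEN BY ITS THM-3.3 BLOCK OVER THE INVARIANT CLASS**: if the (3.42) block of the
invariant-class reading of the bond letter `O` holds at `U₁` with constants `(B₀, δ)`, then at `U = cfg U₁`, under E′₂b's side hypotheses (bi-contractive
bond variables and averaging transporters, holonomy-defect constants `δ_P, ρ, δ_K, δ_I`, `η = |c_f|⁻¹`, a corner-free section `ιB`), for every real
profile `J` with `supp J ⊂ Δ(y′)`, every `Λ` with `‖Λ(x)‖ ≤ |J(x)|` and every bond `x ∈ Δ(y)`: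
`‖(K(h_□)(U)(O(U)(h_□Λ)))(x)‖ ≤ θ₃₈₉ᴮ(j)∕((ℓ+1)·M_h)·e^{−δ d(y,y′)}·|J|`, `j` the index of `□`.
[cite: Balaban1985BackgroundPropagators, p.414 («The operator K(h_□)G_□h_□ satisfies the inequality (3.89), hence it is small»), (3.89) p.409, Thm 3.3 p.399 with (3.42) p.397; Balaban1984PropagatorsII, (2.44) p.230] -/
theorem norm_KhBY_hTY_apply_le_of_eBlockInvB (hE : EBlock (kernelFamilyBInv i B cfg O par) B₀ δ U₁)
    {M₂ : ℝ} (hM₂ : 0 ≤ M₂) (hrepr : ∀ (v : 𝔸) (j : ι), |b.repr v j| ≤ M₂ * ‖v‖)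
    (c : ↥(cubes i.D.toDomains)) (parB : BondParY 𝔸 i) (hB₀ : 0 ≤ B₀) (hδ : 0 ≤ δ)
    (hη : etaS i = |i.cf|⁻¹) (ιB : BlkY i → IBondY i) (hι : ∀ s, β i.hN i.D i.hk (ιB s) = s)
    (hU : ∀ μ x, ‖(cfg U₁ μ x : 𝔸)‖ ≤ 1 ∧ ‖(((cfg U₁ μ x)⁻¹ : 𝔸ˣ) : 𝔸)‖ ≤ 1)
    (hT : ∀ (y : IBondY i) (f : FBondY i), ‖(qT i parB (cfg U₁) y f : 𝔸)‖ ≤ 1 ∧ ‖(((qT i parB (cfg U₁) y f)⁻¹ : 𝔸ˣ) : 𝔸)‖ ≤ 1)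
    {δP ρ δK δI : ℝ} (hδP : 0 ≤ δP) (hρ : 0 ≤ ρ) (hδK : 0 ≤ δK) (hδI : 0 ≤ δI)
    (hP : ∀ (μ lam : Fin (d + 1)) (w : SiteY i) (Y : 𝔸), ‖R (plaqU (shiftY i) (UboxY i (cfg U₁)) μ lam w) Y - Y‖ ≤ δP * ‖Y‖)
    (hRe : ∀ p : PlaqY i, ‖reHolY i (cfg U₁) p‖ ≤ ρ)
    (hKc : ∀ a e (μ : Fin (d + 1)) (x : SiteY i) (Z : 𝔸),
      ‖R (UboxY i (cfg U₁) μ ((shiftY i μ).symm x))⁻¹ (jIns i (cfg U₁) a e ((shiftY i μ).symm x) (R (UboxY i (cfg U₁) μ ((shiftY i μ).symm x)) Z))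
        - jIns i (cfg U₁) a e x Z‖ ≤ δK * ‖Z‖)
    (hI : ∀ p : PlaqY i, ‖((i.cf ^ 2 : ℝ) : ℂ) • imHolY i (cfg U₁) p‖ ≤ δI)
    (J : FBondY i → ℝ) (y y' : IBondY i) (hs : (geo9K i).suppIn (Sum.inr J) y')
    (Λ : FBondY i → 𝔸) (hΛ : ∀ x, ‖Λ x‖ ≤ |J x|) (x : FBondY i) (hx : blkV1 i.hN i.D x = β i.hN i.D i.hk y) :
    ‖KhBY i (hTY i c) parB (cfg U₁) (O (cfg U₁) (cutMulY (hBdY i (hTY i c)) Λ)) x‖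
      ≤ theta389B d ℓ B₀ b₁ δ ρ δP δK δI c.1.1 / (((ℓ : ℝ) + 1) * i.Mh) * Real.exp (-(δ * (geo9K i).dist y y'))
          * (geo9K i).supNorm (Sum.inr J) :=
  norm_KhBY_O_hTY_apply_le i c parB (cfg U₁) (O (cfg U₁)) hB₀ hδ hη ιB hι hU hT hδP hρ hδK hδI hP hRe hKc hI
    (h342₀_of_eBlockInvB i b cfg O par hE hM₂ hrepr) (h342₁_of_eBlockInvB i b cfg O par hE hM₂ hrepr) J y y' hs Λ hΛ x hx

variable [Fintype (geo9K i).Site] {Rr : ℝ} {Hp : Prop}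

/-- ★★ **(B) THE `Factors389.fac` SLOT FOR `K(h_□)G_□(U)h_□`, `G_□` GIVEN BY ITS THM-3.3 BLOCK OVER THE INVARIANT CLASS**: under (A)'s hypotheses, for an
ℝ-linear `Rl` agreeing with `Λ ↦ K(h_□)(U)(O(U)(h_□Λ))` and ANY finset `S′` of index bonds containing every `a` whose carrier block `βa` lies within torus
block distance `2ℓ + 6` of `supp h_□`, the conjugated letter `conj b Rl` has the block majorant
`1[a ∈ S′]·M₂(Σ_j‖b_j‖)·θ₃₈₉ᴮ(j)∕((ℓ+1)·M_h)·e^{−δ d(a,a′)}` w.r.t. `(x, j) ↦ ιB(Δ(x))` in the geometry `toB6 (geo9K i) Rr Hp` — print's «localized in X …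
and satisfies a bound of the type (3.89)» for the factors `K(h_□)G_□h_□` of `R`.
[cite: Balaban1985BackgroundPropagators, p.413 («localized in X … satisfies a bound of the type (3.89)»), (3.105) p.414, (3.89) p.409, Thm 3.3 p.399 with (3.42) p.397; Balaban1984PropagatorsII, (2.44) p.230, (2.51) p.232] -/
theorem hasMajorant_conj_KhBY_hTY_of_eBlockInvB (hE : EBlock (kernelFamilyBInv i B cfg O par) B₀ δ U₁)
    {M₂ : ℝ} (hM₂ : 0 ≤ M₂) (hrepr : ∀ (v : 𝔸) (j : ι), |b.repr v j| ≤ M₂ * ‖v‖)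
    (c : ↥(cubes i.D.toDomains)) (parB : BondParY 𝔸 i) (hB₀ : 0 ≤ B₀) (hδ : 0 ≤ δ)
    (hη : etaS i = |i.cf|⁻¹) (ιB : BlkY i → IBondY i) (hι : ∀ s, β i.hN i.D i.hk (ιB s) = s)
    (hU : ∀ μ x, ‖(cfg U₁ μ x : 𝔸)‖ ≤ 1 ∧ ‖(((cfg U₁ μ x)⁻¹ : 𝔸ˣ) : 𝔸)‖ ≤ 1)
    (hT : ∀ (y : IBondY i) (f : FBondY i), ‖(qT i parB (cfg U₁) y f : 𝔸)‖ ≤ 1 ∧ ‖(((qT i parB (cfg U₁) y f)⁻¹ : 𝔸ˣ) : 𝔸)‖ ≤ 1)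
    {δP ρ δK δI : ℝ} (hδP : 0 ≤ δP) (hρ : 0 ≤ ρ) (hδK : 0 ≤ δK) (hδI : 0 ≤ δI)
    (hP : ∀ (μ lam : Fin (d + 1)) (w : SiteY i) (Y : 𝔸), ‖R (plaqU (shiftY i) (UboxY i (cfg U₁)) μ lam w) Y - Y‖ ≤ δP * ‖Y‖)
    (hRe : ∀ p : PlaqY i, ‖reHolY i (cfg U₁) p‖ ≤ ρ)
    (hKc : ∀ a e (μ : Fin (d + 1)) (x : SiteY i) (Z : 𝔸),
      ‖R (UboxY i (cfg U₁) μ ((shiftY i μ).symm x))⁻¹ (jIns i (cfg U₁) a e ((shiftY i μ).symm x) (R (UboxY i (cfg U₁) μ ((shiftY i μ).symm x)) Z))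
        - jIns i (cfg U₁) a e x Z‖ ≤ δK * ‖Z‖)
    (hI : ∀ p : PlaqY i, ‖((i.cf ^ 2 : ℝ) : ℂ) • imHolY i (cfg U₁) p‖ ≤ δI)
    (Rl : Module.End ℝ (FBondY i → 𝔸)) (hRl : ∀ Λ, Rl Λ = KhBY i (hTY i c) parB (cfg U₁) (O (cfg U₁) (cutMulY (hBdY i (hTY i c)) Λ)))
    (S' : Finset (IBondY i))
    (hS' : ∀ a : IBondY i, (∃ u : SiteY i, hTY i c u ≠ 0 ∧ ((bondT i.D).dist (β i.hN i.D i.hk a) (blkOf i.D.toDomains u) : ℝ) ≤ 2 * (ℓ : ℝ) + 6) →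
      a ∈ S') :
    HasMajorant (g := toB6 (geo9K i) Rr Hp) (fun p : FBondY i × ι => ιB (blkV1 i.hN i.D p.1)) (conj b Rl)
      (fun a a' => if a ∈ S' then M₂ * (∑ j, ‖b j‖) * (theta389B d ℓ B₀ b₁ δ ρ δP δK δI c.1.1 / (((ℓ : ℝ) + 1) * i.Mh))
        * Real.exp (-(δ * (geo9K i).dist a a')) else 0) :=
  hasMajorant_conj_of_bound389B i b c parB (cfg U₁) (O (cfg U₁)) hB₀ hδ hη ιB hι hU hT hδP hρ hδK hδI hP hRe hKc hI
    (h342₀_of_eBlockInvB i b cfg O par hE hM₂ hrepr) (h342₁_of_eBlockInvB i b cfg O par hE hM₂ hrepr) hM₂ hrepr Rl hRl S' hS'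

/-- ★★ **(C) THE SAME MAJORANT IN THE GLUE'S LITERAL `Factors389.fac` SUMMAND SHAPE** `1[a ∈ S′]·θ₀·M⁻¹·e^{−δ d(a,a′)}`, `M = (geo9K i).M = (ℓ+1)·M_h` (the
reading dictionary's `M`), `θ₀ = M₂(Σ_j‖b_j‖)·θ₃₈₉ᴮ(j)` — so that, with `Ops310.Rf U a := conj b Rl_□`, `Ops310.SF a := S′_□`, `Ops310.blk := (x, j) ↦ ιB(Δ(x))`,
the field `fac` of `B9Thm310Whole.Factors389` is served for the factors `K(h_□)G_□h_□` by `exact`.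
[cite: Balaban1985BackgroundPropagators, p.413 («satisfies a bound of the type (3.89)»), (3.105) p.414, (3.89) p.409 («O(M⁻¹)e^{−δ₀(Lʲη)⁻¹|y−y′|}»); Balaban1984PropagatorsII, (2.44) p.230, (2.51) p.232] -/
theorem hasMajorant_conj_KhBY_hTY_of_eBlockInvB_fac (hE : EBlock (kernelFamilyBInv i B cfg O par) B₀ δ U₁)
    {M₂ : ℝ} (hM₂ : 0 ≤ M₂) (hrepr : ∀ (v : 𝔸) (j : ι), |b.repr v j| ≤ M₂ * ‖v‖)
    (c : ↥(cubes i.D.toDomains)) (parB : BondParY 𝔸 i) (hB₀ : 0 ≤ B₀) (hδ : 0 ≤ δ)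
    (hη : etaS i = |i.cf|⁻¹) (ιB : BlkY i → IBondY i) (hι : ∀ s, β i.hN i.D i.hk (ιB s) = s)
    (hU : ∀ μ x, ‖(cfg U₁ μ x : 𝔸)‖ ≤ 1 ∧ ‖(((cfg U₁ μ x)⁻¹ : 𝔸ˣ) : 𝔸)‖ ≤ 1)
    (hT : ∀ (y : IBondY i) (f : FBondY i), ‖(qT i parB (cfg U₁) y f : 𝔸)‖ ≤ 1 ∧ ‖(((qT i parB (cfg U₁) y f)⁻¹ : 𝔸ˣ) : 𝔸)‖ ≤ 1)
    {δP ρ δK δI : ℝ} (hδP : 0 ≤ δP) (hρ : 0 ≤ ρ) (hδK : 0 ≤ δK) (hδI : 0 ≤ δI)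
    (hP : ∀ (μ lam : Fin (d + 1)) (w : SiteY i) (Y : 𝔸), ‖R (plaqU (shiftY i) (UboxY i (cfg U₁)) μ lam w) Y - Y‖ ≤ δP * ‖Y‖)
    (hRe : ∀ p : PlaqY i, ‖reHolY i (cfg U₁) p‖ ≤ ρ)
    (hKc : ∀ a e (μ : Fin (d + 1)) (x : SiteY i) (Z : 𝔸),
      ‖R (UboxY i (cfg U₁) μ ((shiftY i μ).symm x))⁻¹ (jIns i (cfg U₁) a e ((shiftY i μ).symm x) (R (UboxY i (cfg U₁) μ ((shiftY i μ).symm x)) Z))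
        - jIns i (cfg U₁) a e x Z‖ ≤ δK * ‖Z‖)
    (hI : ∀ p : PlaqY i, ‖((i.cf ^ 2 : ℝ) : ℂ) • imHolY i (cfg U₁) p‖ ≤ δI)
    (Rl : Module.End ℝ (FBondY i → 𝔸)) (hRl : ∀ Λ, Rl Λ = KhBY i (hTY i c) parB (cfg U₁) (O (cfg U₁) (cutMulY (hBdY i (hTY i c)) Λ)))
    (S' : Finset (IBondY i))
    (hS' : ∀ a : IBondY i, (∃ u : SiteY i, hTY i c u ≠ 0 ∧ ((bondT i.D).dist (β i.hN i.D i.hk a) (blkOf i.D.toDomains u) : ℝ) ≤ 2 * (ℓ : ℝ) + 6) →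
      a ∈ S') :
    HasMajorant (g := toB6 (geo9K i) Rr Hp) (fun p : FBondY i × ι => ιB (blkV1 i.hN i.D p.1)) (conj b Rl)
      (fun a a' => if a ∈ S' then M₂ * (∑ j, ‖b j‖) * theta389B d ℓ B₀ b₁ δ ρ δP δK δI c.1.1 * ((geo9K i).M)⁻¹
        * Real.exp (-(δ * (geo9K i).dist a a')) else 0) := by
  have hMdef : (geo9K i).M = (((ℓ + 1 : ℕ) : ℝ)) * (i.Mh : ℝ) := rfl
  refine hasMajorant_mono (g := toB6 (geo9K i) Rr Hp) _
    (hasMajorant_conj_KhBY_hTY_of_eBlockInvB i b cfg O par hE hM₂ hrepr c parB hB₀ hδ hη ιB hι hU hT hδP hρ hδK hδI hP hRe hKc hI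
      Rl hRl S' hS') fun a a' => le_of_eq ?_
  show (if a ∈ S' then M₂ * (∑ j, ‖b j‖) * (theta389B d ℓ B₀ b₁ δ ρ δP δK δI c.1.1 / (((ℓ : ℝ) + 1) * i.Mh))
      * Real.exp (-(δ * (geo9K i).dist a a')) else 0) =
    (if a ∈ S' then M₂ * (∑ j, ‖b j‖) * theta389B d ℓ B₀ b₁ δ ρ δP δK δI c.1.1 * ((geo9K i).M)⁻¹
      * Real.exp (-(δ * (geo9K i).dist a a')) else 0)
  split_ifs
  · rw [hMdef, div_eq_mul_inv]
    push_cast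
    ring
  · rfl

end Literature.MathematicalPhysics.QuantumFieldTheory.Balaban1983to89.B9Thm310CommutatorBound389BOfInv

end
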